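import Summits.ValiantsHypothesis.ValiantsHypothesis.Theorems.DivisionGapPerDivisionHardStubSubexpRigid
import Summits.ValiantsHypothesis.ValiantsHypothesis.Theorems.DivisionGapPerDivisionHardStubAtomicTop
import Summits.ValiantsHypothesis.ValiantsHypothesis.Theorems.DivisionGapPerDivisionHardCutsOutDiag

/-!
# Crux `DivisionGap.PerDivisionHard` (stmt-ValiantsHypothesis-5065), line `pair-descent-jss-endpoint` —
stub `stub_pairPlacement`, auxiliary file: rigidity of good placements, column labellings avoiding
two cells, supports of atomic terms, bookkeeping

Vocabulary-level ingredients of `stub_pairPlacement`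
(`Theorems/DivisionGapPerDivisionHardStubPairPlacement.lean`), all elementary:

* `rigid_of_rows` — the girth substitute of the block arsenal in the form used three times by the
  stub: if the core and internal row labels of a placement `eR eC` of `G(b,k) ⊕ M₀` (`k ≥ 1`) land
  in a row set `R` containing no LARGE (`≥ 4k + 2`) row set of an integer matrix `D` with vanishing
  row and column sums, and `D` vanishes off the placed face, then `D = 0`
  (`placedFlow_card_rows`, `placedFlow_row_notPadding`).
* `exists_colEquiv_avoiding` (registered sub-goal form: `stub_pairPlacement_cols`) — for any
  row labelling `eR` and `m ≥ 4` padding labels there is a column labelling `eC` keeping two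
  prescribed cells `ep, em` outside `placedBlock eR eC` (make `ep.2, em.2` padding columns whose
  padding rows differ from `ep.1, em.1`; a cell of the face in a padding column is the padding
  cell, `eq_pad_of_mem_placedBlock_col` of `Theorems/DivisionGapPerDivisionHardCutsOutDiag.lean`).
* `add_sum_nsmul_mem_support` — over `ℝ≥0` the exponent `C + Σ_β μ β • g β` (one monomial `g β`
  per atom) is a monomial of the term `c • x^C • ∏_β F_β^{μ β}` (`JerrumSnir.support_mul_eq`).
* `comb_margins` — integer combinations of matrices with vanishing margins have vanishing
  margins; `sum_term_eq_sub` — the vector `V_{l₁ l₂}` of the stub is the difference of the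
  exponents of the two terms when all separating atoms are monomials.
* `count_bound` — the arithmetic of the union bound.
-/

noncomputable section

-- `Summit.ValiantsHypothesis.ValiantsHypothesis.…` is the tree's mandated single-conjunct layout
-- (Sub = Summit), so the duplicated namespace component is intended.
set_option linter.dupNamespace false

namespace Summit.ValiantsHypothesis.ValiantsHypothesis.Theorems.DivisionGapPerDivisionHard

open MvPolynomial Literature.Computability.AlgebraicComplexity
open Literature.Barriers.ValiantsHypothesis
open Summit.ValiantsHypothesis.ValiantsHypothesis.Theorems.ZeroOneTransfer.Negative
open scoped NNReal Pointwise

variable {b k m n : ℕ}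

/-! ### Rigidity of a good placement -/

/-- **The girth substitute, placed and counted.**  If the core and internal rows of the placement
`eR` lie in `R`, `R` contains the row set of the integer matrix `D` only if that row set is small
(`< 4k + 2`), `D` has vanishing row and column sums and vanishes off the placed face, then `D = 0`:
otherwise `D` is a nonzero circulation of the placed block arsenal, which occupies `≥ 4k + 2` rows
(`placedFlow_card_rows`), none of them a padding row (`placedFlow_row_notPadding`). [folklore] -/
theorem rigid_of_rows (eR eC : BlockV b k m ≃ Fin n) (hk : 0 < k) (R : Finset (Fin n))
    (heR₁ : ∀ i, eR (Sum.inl i) ∈ R) (heR₂ : ∀ p, eR (Sum.inr (Sum.inl p)) ∈ R)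
    {D : Fin n × Fin n → ℤ}
    (hgood : 4 * k + 2 ≤ (Finset.univ.filter fun r : Fin n => ∃ c, D (r, c) ≠ 0).card →
      ¬ ((Finset.univ.filter fun r : Fin n => ∃ c, D (r, c) ≠ 0) ⊆ R))
    (hrow : ∀ r, ∑ c, D (r, c) = 0) (hcol : ∀ c, ∑ r, D (r, c) = 0)
    (hoff : ∀ e ∉ placedBlock eR eC, D e = 0) : ∀ e, D e = 0 := by
  by_contra hne
  push Not at hne
  have hDG : ∀ e, D e ≠ 0 → e ∈ placedBlock eR eC := fun e he => by
    by_contra heG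
    exact he (hoff e heG)
  refine hgood (placedFlow_card_rows eR eC hk hDG hrow hcol hne) fun r hr => ?_
  obtain ⟨c', hc'⟩ := (Finset.mem_filter.mp hr).2
  have hpad := placedFlow_row_notPadding eR eC hDG hrow hcol hc'
  obtain ⟨x, rfl⟩ := eR.surjective r
  rcases x with i | p | u
  · exact heR₁ i
  · exact heR₂ p
  · exact absurd (eR.symm_apply_apply _) (hpad u)

/-! ### Column labellings avoiding two cells -/

/-- A permutation with two prescribed values at two distinct points. [folklore] -/
theorem exists_perm_apply_eq_pair {α : Type*} [DecidableEq α] {x₁ x₂ y₁ y₂ : α} (hx : x₁ ≠ x₂)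
    (hy : y₁ ≠ y₂) : ∃ σ : Equiv.Perm α, σ x₁ = y₁ ∧ σ x₂ = y₂ := by
  refine ⟨(Equiv.swap x₁ y₁).trans (Equiv.swap (Equiv.swap x₁ y₁ x₂) y₂), ?_, ?_⟩
  · rw [Equiv.trans_apply, Equiv.swap_apply_left, Equiv.swap_apply_of_ne_of_ne _ hy]
    intro h
    have h' := congrArg (Equiv.swap x₁ y₁) h
    rw [Equiv.swap_apply_right, Equiv.swap_apply_self] at h'
    exact hx h'
  · rw [Equiv.trans_apply, Equiv.swap_apply_left]

/-- **Column labellings avoiding two cells.**  For every row labelling `eR` of `G(b,k) ⊕ M₀` with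
`m ≥ 4` padding labels and every two cells `ep, em` there is a column labelling `eC` with
`ep, em ∉ placedBlock eR eC`: make `ep.2`, `em.2` padding columns whose padding rows differ from
`ep.1`, `em.1`. [folklore] -/
theorem exists_colEquiv_avoiding (eR : BlockV b k m ≃ Fin n) (hm : 4 ≤ m) (ep em : Fin n × Fin n) :
    ∃ eC : BlockV b k m ≃ Fin n, ep ∉ placedBlock eR eC ∧ em ∉ placedBlock eR eC := by
  classical
  -- the padding rows
  set ρ : Fin m → Fin n := fun u => eR (Sum.inr (Sum.inr u)) with hρ
  have hρinj : Function.Injective ρ := fun u v huv => by simpa [ρ] using huv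
  -- padding labels whose row is `ep.1` or `em.1` are forbidden: at most two of them
  set Bad : Finset (Fin m) := Finset.univ.filter fun u => ρ u = ep.1 ∨ ρ u = em.1 with hBad
  have hBad2 : Bad.card ≤ 2 :=
    calc Bad.card ≤ ({ep.1, em.1} : Finset (Fin n)).card := by
          refine Finset.card_le_card_of_injOn ρ (fun u hu => ?_)
            (hρinj.injOn.mono (Set.subset_univ _))
          have := (Finset.mem_filter.mp (Finset.mem_coe.mp hu)).2
          simpa using this
      _ ≤ 2 := Finset.card_le_two
  obtain ⟨u₁, -, hu₁⟩ := Finset.exists_mem_notMem_of_card_lt_card (s := Bad) (t := Finset.univ)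
    (by rw [Finset.card_univ, Fintype.card_fin]; omega)
  obtain ⟨u₂, -, hu₂⟩ := Finset.exists_mem_notMem_of_card_lt_card (s := insert u₁ Bad)
    (t := Finset.univ) (by
      rw [Finset.card_univ, Fintype.card_fin]
      exact lt_of_le_of_lt (Finset.card_insert_le _ _) (by omega))
  have hu₁' : ρ u₁ ≠ ep.1 ∧ ρ u₁ ≠ em.1 := by
    simpa [hBad, not_or] using hu₁
  have hu₂' : u₂ ≠ u₁ ∧ ρ u₂ ≠ ep.1 ∧ ρ u₂ ≠ em.1 := by
    simpa [hBad, not_or] using hu₂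
  -- two padding labels and a permutation of the columns sending their rows to `ep.2`, `em.2`
  obtain ⟨v₁, v₂, hv₁, hv₂, σ, hσ₁, hσ₂⟩ : ∃ v₁ v₂ : Fin m, ρ v₁ ≠ ep.1 ∧ ρ v₂ ≠ em.1 ∧
      ∃ σ : Equiv.Perm (Fin n), σ (ρ v₁) = ep.2 ∧ σ (ρ v₂) = em.2 := by
    by_cases hpm : ep.2 = em.2
    · refine ⟨u₁, u₁, hu₁'.1, hu₁'.2, Equiv.swap (ρ u₁) ep.2, Equiv.swap_apply_left _ _, ?_⟩
      rw [Equiv.swap_apply_left, hpm]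
    · exact ⟨u₁, u₂, hu₁'.1, hu₂'.2.2,
        exists_perm_apply_eq_pair (fun h => hu₂'.1 (hρinj h).symm) hpm⟩
  refine ⟨eR.trans σ, fun hmem => hv₁ ?_, fun hmem => hv₂ ?_⟩
  · refine (eq_pad_of_mem_placedBlock_col eR (eR.trans σ) (u := v₁) ?_).symm
    rwa [Equiv.trans_apply, show eR (Sum.inr (Sum.inr v₁)) = ρ v₁ from rfl, hσ₁, Prod.mk.eta]
  · refine (eq_pad_of_mem_placedBlock_col eR (eR.trans σ) (u := v₂) ?_).symm
    rwa [Equiv.trans_apply, show eR (Sum.inr (Sum.inr v₂)) = ρ v₂ from rfl, hσ₂, Prod.mk.eta]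

/-- **`stub_pairPlacement`, part Aux (registered sub-goal): column labellings avoiding two
cells.**  For every row labelling `eR` of `G(b,k) ⊕ M₀` with at least `4` padding labels and every
two cells `ep, em`, some column labelling `eC` keeps `ep, em` outside `placedBlock eR eC`.
[folklore] -/
theorem stub_pairPlacement_cols :
    ∀ (b k m n : ℕ) (eR : BlockV b k m ≃ Fin n) (ep em : Fin n × Fin n), 4 ≤ m →
      ∃ eC : BlockV b k m ≃ Fin n, ep ∉ placedBlock eR eC ∧ em ∉ placedBlock eR eC :=
  fun _ _ _ _ eR ep em hm => exists_colEquiv_avoiding eR hm ep em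

/-! ### Supports of atomic terms over `ℝ≥0` -/

/-- Over `ℝ≥0`, `μ • g` is a monomial of `G ^ μ` for every monomial `g` of `G`. [folklore] -/
theorem nsmul_mem_support_pow {σ : Type*} [DecidableEq σ] {G : MvPolynomial σ ℝ≥0} {g : σ →₀ ℕ}
    (hg : g ∈ G.support) : ∀ μ : ℕ, μ • g ∈ (G ^ μ).support
  | 0 => by
    rw [zero_smul, pow_zero, mem_support_iff, coeff_one, if_pos rfl]
    exact one_ne_zero
  | μ + 1 => by
    rw [succ_nsmul, pow_succ, JerrumSnir.support_mul_eq]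
    exact Finset.add_mem_add (nsmul_mem_support_pow hg μ) hg

/-- Over `ℝ≥0`, `Σ_{x ∈ s} μ x • g x` is a monomial of `∏_{x ∈ s} G x ^ μ x` for every choice of
monomials `g x` of the `G x`. [folklore] -/
theorem sum_nsmul_mem_support_prod_pow {σ α : Type*} [DecidableEq σ] (s : Finset α)
    (G : α → MvPolynomial σ ℝ≥0) (g : α → σ →₀ ℕ) (μ : α → ℕ)
    (hg : ∀ x ∈ s, g x ∈ (G x).support) :
    ∑ x ∈ s, μ x • g x ∈ (∏ x ∈ s, G x ^ μ x).support := by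
  classical
  induction s using Finset.induction_on with
  | empty =>
    rw [Finset.sum_empty, Finset.prod_empty, mem_support_iff, coeff_one, if_pos rfl]
    exact one_ne_zero
  | insert a s ha ih =>
    rw [Finset.sum_insert ha, Finset.prod_insert ha, JerrumSnir.support_mul_eq]
    exact Finset.add_mem_add (nsmul_mem_support_pow (hg a (Finset.mem_insert_self a s)) _)
      (ih fun x hx => hg x (Finset.mem_insert_of_mem hx))

/-- **The exponent of a term.**  Over `ℝ≥0`, `C + Σ_{β ∈ I} μ β • g β` is a monomial of the term
`c • x^C • ∏_{β ∈ I} F_β^{μ β}` (`c ≠ 0`) for every choice of monomials `g β` of the atoms.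
[folklore] -/
theorem add_sum_nsmul_mem_support {σ ι : Type*} (I : Finset ι) (F : ι → MvPolynomial σ ℝ≥0)
    (g : ι → σ →₀ ℕ) (μ : ι → ℕ) (hg : ∀ β ∈ I, g β ∈ (F β).support) {c : ℝ≥0} (hc : c ≠ 0)
    (C : σ →₀ ℕ) :
    C + ∑ β ∈ I, μ β • g β ∈ (c • (monomial C (1 : ℝ≥0) * ∏ β ∈ I, F β ^ μ β)).support := by
  classical
  rw [JerrumSnir.support_smul_eq hc, JerrumSnir.support_mul_eq]
  refine Finset.add_mem_add ?_ (sum_nsmul_mem_support_prod_pow I F g μ hg)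
  rw [mem_support_iff, coeff_monomial, if_pos rfl]
  exact one_ne_zero

/-! ### The bad vectors and their margins -/

/-- An integer combination `B • u - A • v` of two integer matrices with vanishing row and column
sums has vanishing row and column sums. [folklore] -/
theorem comb_margins {u v : Fin n × Fin n → ℤ} (A B : ℤ)
    (hu : (∀ r, ∑ c, u (r, c) = 0) ∧ ∀ c, ∑ r, u (r, c) = 0)
    (hv : (∀ r, ∑ c, v (r, c) = 0) ∧ ∀ c, ∑ r, v (r, c) = 0) :
    (∀ r, ∑ c, (B * u (r, c) - A * v (r, c)) = 0) ∧
      ∀ c, ∑ r, (B * u (r, c) - A * v (r, c)) = 0 := by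
  refine ⟨fun r => ?_, fun c => ?_⟩
  · rw [Finset.sum_sub_distrib, ← Finset.mul_sum, ← Finset.mul_sum, hu.1, hv.1, mul_zero,
      mul_zero, sub_self]
  · rw [Finset.sum_sub_distrib, ← Finset.mul_sum, ← Finset.mul_sum, hu.2, hv.2, mul_zero,
      mul_zero, sub_self]

/-- **The vector `V_{l₁ l₂}` is a difference of two term exponents.**  If every atom separating
the terms `l₁, l₂` (`μ l₁ β ≠ μ l₂ β`) is a monomial, then
`C l₁ - C l₂ + Σ_β (μ l₁ β - μ l₂ β) • Σ_{f ∈ supp F_β} f` is the difference of the exponents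
`C l + Σ_β μ l β • g β` for any choice of monomials `g β ∈ supp F_β`. [folklore] -/
theorem sum_term_eq_sub {ι κ : Type*} (I : Finset ι) (F : ι → MvPolynomial (Fin n × Fin n) ℝ≥0)
    (g : ι → (Fin n × Fin n) →₀ ℕ) (hg : ∀ β ∈ I, g β ∈ (F β).support)
    (C : κ → (Fin n × Fin n) →₀ ℕ) (μ : κ → ι → ℕ) {l₁ l₂ : κ}
    (hsep : ∀ β ∈ I, μ l₁ β ≠ μ l₂ β → (F β).support.card = 1) (e : Fin n × Fin n) :
    (C l₁ e : ℤ) - C l₂ e + ∑ β ∈ I, ((μ l₁ β : ℤ) - μ l₂ β) * ∑ f ∈ (F β).support, (f e : ℤ) =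
      ((C l₁ + ∑ β ∈ I, μ l₁ β • g β) e : ℤ) - (C l₂ + ∑ β ∈ I, μ l₂ β • g β) e := by
  have hβ : ∀ β ∈ I, ((μ l₁ β : ℤ) - μ l₂ β) * ∑ f ∈ (F β).support, (f e : ℤ) =
      ((μ l₁ β : ℤ) - μ l₂ β) * g β e := by
    intro β hβI
    by_cases hμ : μ l₁ β = μ l₂ β
    · rw [hμ, sub_self, zero_mul, zero_mul]
    · obtain ⟨f₀, hf₀⟩ := Finset.card_eq_one.mp (hsep β hβI hμ)
      have : g β = f₀ := Finset.mem_singleton.mp (hf₀ ▸ hg β hβI)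
      rw [hf₀, Finset.sum_singleton, this]
  rw [Finset.sum_congr rfl hβ]
  simp only [Finsupp.coe_add, Finsupp.coe_finsetSum, Pi.add_apply, Finset.sum_apply,
    Finsupp.coe_smul, Pi.smul_apply, smul_eq_mul, Nat.cast_add, Nat.cast_sum, Nat.cast_mul,
    Finset.sum_sub_distrib, sub_mul]
  ring

/-! ### Bookkeeping -/

/-- The union bound of `stub_pairPlacement`: `4c + 16 c² n² + 4 ≤ 2^{4k+2}` for `c ≤ 2^k` atoms
once `16 n² ≤ 2^{2k}` (`k ≥ 1`). [folklore] -/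
theorem count_bound {k n c : ℕ} (hk : 0 < k) (hn : 16 * (n * n) ≤ 2 ^ (2 * k)) (hc : c ≤ 2 ^ k) :
    c * 4 + c * c * (4 * (4 * (n * n))) + 2 * 2 ≤ 2 ^ (4 * k + 2) := by
  set x := 2 ^ k with hx
  have hx2 : 2 ≤ x := by
    calc (2 : ℕ) = 2 ^ 1 := (pow_one 2).symm
      _ ≤ 2 ^ k := Nat.pow_le_pow_right two_pos hk
  have h2k : 2 ^ (2 * k) = x * x := by rw [two_mul, pow_add]
  have h4k : 2 ^ (4 * k + 2) = 4 * (x * x * (x * x)) := by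
    rw [pow_add, show 4 * k = 2 * k + 2 * k by ring, pow_add, h2k]; ring
  rw [h2k] at hn
  rw [h4k]
  have h1 : c * c * (4 * (4 * (n * n))) ≤ x * x * (x * x) := by
    rw [show 4 * (4 * (n * n)) = 16 * (n * n) by ring]
    exact Nat.mul_le_mul (Nat.mul_le_mul hc hc) hn
  have h2 : c * 4 + 2 * 2 ≤ 3 * (x * x * (x * x)) := by
    have : x * x * (x * x) ≥ 2 * 2 * (2 * x) :=
      Nat.mul_le_mul (Nat.mul_le_mul hx2 hx2) (Nat.mul_le_mul_right x hx2)
    omega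
  omega

end Summit.ValiantsHypothesis.ValiantsHypothesis.Theorems.DivisionGapPerDivisionHard

end
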